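import Summits.BirchSwinnertonDyer.BirchSwinnertonDyer.Theses.PrintX6
import Summits.BirchSwinnertonDyer.Rank1Residual.Supersingular.KobayashiMainConjecture
import Literature.NumberTheory.EllipticCurves.PlusMinusPAdicLFunctionProofs
import HarnessLib

/-!
# Route `PrintX6`, crux `EisensteinHalfFiveLe` (stmt-BirchSwinnertonDyer-20276): birth-skeleton rev 2, stub 2
# `stub_signedDescentRankZero` CLOSED BY NAME (cell `bsd-print-x6`, seat p4; `--supports` the crux, closes no item)

PARTITION currency (D-0054): leaf A6 = X6 ∧ r_an = 0; this is the DESCENT stub of the crux skeleton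
(`EisensteinHalfFiveLe_of (hPub : PublishedInputsX6)` = stub 1 `stub_signedLowerDivisibilityFiveLe` [the OPEN content:
one-sign Eisenstein divisibility of Kobayashi's signed main conjecture on X6 ∩ {r_an = 0}, p ≥ 5 — K3 stmt-19000 restricted]
∘ stub 2 [this file]). Registered signature (planner gen 1, 2026-08-27T14:35:31Z, skeleton 64f82d60b9b6), verbatim:
`PublishedInputsX6 → ∀ W p, p ≠ 2 → ClassX6 W p → r_an = 0 → (∃ ε, KobayashiLowerDivisibility W p ε) → ∀ q, #Ш_an = q →
ord_p q ≠ 0 → ord_p q ≤ ord_p #Ш(E/ℚ)`. The same stub (same name, same signature) is stub 2 of the residual crux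
`EisensteinHalfAtThree` (stmt-20285); its twin lives in `PrintX6EisensteinHalfAtThreeStubDescent.lean`. BEYOND-PRINT THEOREM:
**NO** — the content is the tree theorem `Supersingular.missingLowerBoundAt_of_kobayashiLowerDivisibility` (b2b-bsdres; Kobayashi
2003 Thm 1.2, B. D. Kim 2013 Cor 3.15, Pollack 2003 — a tree THEOREM —, modularity, GZK) fed conjuncts 1, 3, 7, 8, 9 of the
route's input pack and rewired to the ∀q / non-unit form (this seat's `PrintX6.signedDescentRankZero_of_inputs`, p535256, has
the same type with `hPub` named; restated here under the registered stub name so the gate can bind it, proof inlined so that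
this module imports the route file and route-independent modules only). Nothing is booked; the crux stays OPEN (stub 1).

References: Kobayashi 2003 Thm 1.2, (3.6) [Kobayashi2003]; B. D. Kim 2013 Cor 3.15 [BDKim2013]; Pollack 2003 Prop 6.18
[Pollack2003]; Miller 2011 Def 1.1 [Miller2011LMS]; HOME/PLAN.md v2 p4 (0).
-/

set_option autoImplicit false
set_option linter.dupNamespace false

noncomputable section

open scoped Classical

open WeierstrassCurve Literature.NumberTheory.EllipticCurves
  Literature.NumberTheory.EllipticCurves.Rank1Residual
  Literature.NumberTheory.EllipticCurves.Rank1Residual.Typed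
  Summit.BirchSwinnertonDyer.Rank1Residual.Supersingular
  Summit.BirchSwinnertonDyer.BirchSwinnertonDyer.Theses.PrintX6

namespace Summit.BirchSwinnertonDyer.BirchSwinnertonDyer.Theorems.PrintX6.EisensteinHalfFiveLe

/-- **Skeleton stub 2 of crux `EisensteinHalfFiveLe`, BY NAME (registered signature verbatim).** Granted the route's
inputs `PublishedInputsX6`: at every X6 pair with odd `p` and `ord_{s=1} L(E,s) = 0`, the Eisenstein divisibility
`KobayashiLowerDivisibility W p ε` for ONE sign forces `ord_p q ≤ ord_p #Ш(E/ℚ)` for the rational `q = #Ш(E)_an` (the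
non-unit proviso `ord_p q ≠ 0` is not needed). Proof: `missingLowerBoundAt_of_kobayashiLowerDivisibility` with Kobayashi
Thm 1.2 (`h12`), Kim Cor 3.15 (`hKim`), Pollack (tree theorem `pollack_exists_plusMinusPAdicLFunction_holds`), modularity
(`hmodP`, `hmod` for `r_an = 0 ⇒ L(E,1) ≠ 0`), GZK (`hGZK`); `a_p = 0` and `E[p]` irreducible from `ClassX6`; the witness
of `MissingLowerBoundAt` is THE `q` since `shaAn W = q` determines `q`. CONDITIONAL on the inputs and the divisibility.
[cite: Kobayashi2003, Thm. 1.2 and (3.6)] [cite: BDKim2013, Cor. 3.15 (p. 199)] [cite: Pollack2003, Prop. 6.18]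
[cite: Miller2011LMS, Def. 1.1] -/
theorem stub_signedDescentRankZero : Summit.BirchSwinnertonDyer.BirchSwinnertonDyer.Theses.PrintX6.PublishedInputsX6 → ∀ (W : WeierstrassCurve ℚ) [W.IsElliptic] [W.IsGloballyMinimal] (p : ℕ) [Fact p.Prime], p ≠ 2 → Literature.NumberTheory.EllipticCurves.Rank1Residual.ClassX6 W p → W.analyticRank = 0 → (∃ ε : ℤˣ, Summit.BirchSwinnertonDyer.Rank1Residual.Supersingular.KobayashiLowerDivisibility W p ε) → ∀ q : ℚ, Literature.NumberTheory.EllipticCurves.shaAn W = (q : ℂ) → padicValRat p q ≠ 0 → padicValRat p q ≤ (padicValNat p W.shaOrder : ℤ) := by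
  intro hPub
  obtain ⟨h12, -, hKim, -, -, -, hmodP, hmod, hGZK⟩ := hPub
  intro W _ _ p _ hp hX hr hε q hq _
  obtain ⟨ε, hdiv⟩ := hε
  have hL : W.entireLFunction 1 ≠ 0 := (W.analyticRank_eq_zero_iff_holds (hmod W)).1 hr
  obtain ⟨q', hq', hle⟩ := missingLowerBoundAt_of_kobayashiLowerDivisibility W p h12 hKim
    pollack_exists_plusMinusPAdicLFunction_holds hmodP hGZK hp hX.1.1
    (ClassX6.frobeniusTrace_eq_zero W p hp hX) (ClassX6.irr W p hp hX) hL hdiv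
  have hqq : q' = q := by exact_mod_cast hq'.symm.trans hq
  subst hqq
  exact hle

end Summit.BirchSwinnertonDyer.BirchSwinnertonDyer.Theorems.PrintX6.EisensteinHalfFiveLe

end
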